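import Summits.KontsevichZagierPeriods.KontsevichZagierPeriods.Theorems.SoloInformedParamCoV
import Summits.KontsevichZagierPeriods.KontsevichZagierPeriods.Theorems.SoloInformedParamNLMeaning
import HarnessLib

/-!
# Meaning of the change-of-variables clauses

At a parameter where the graph fibres are graphs of functions (`Φ` for the map term, `g`, `g'` for
the two integrand terms) the clauses of `SoloInformedParamCoV` say exactly:

* `injClause_iff` — `Φ` is injective on the domain `D`;
* `imgClause_iff` — the domain of the second term is `Φ '' D`;
* `diffClause_iff` — every `x ∈ D` admits a matrix `L` with `g x = g' (Φ x)·|det L|` and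
  `HasFDerivWithinAt Φ L D x` (the `ε`–`δ` clause is the Fréchet derivative in the sup norm,
  `soloInformed_hasFDerivWithinAt_matrix_iff`).

References: [cite: KontsevichZagier2001, §1.2 rule (2)]; [cite: BochnakCosteRoy1998, Prop. 2.9.1].
-/

noncomputable section

open Set Literature.ModelTheory.ExponentialFields Literature.NumberTheory.Transcendental

namespace Summit.KontsevichZagierPeriods.KontsevichZagierPeriods.Theorems

/-! ### `ε`–`δ` forms of the Fréchet derivative -/

/-- The `ε`–`δ` form of `HasFDerivWithinAt`. [folklore] -/
theorem soloInformed_hasFDerivWithinAt_iff_eps_delta {E F : Type*} [NormedAddCommGroup E]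
    [NormedSpace ℝ E] [NormedAddCommGroup F] [NormedSpace ℝ F] {f : E → F} {f' : E →L[ℝ] F}
    {s : Set E} {x : E} :
    HasFDerivWithinAt f f' s x ↔ ∀ ε > 0, ∃ δ > 0, ∀ x' ∈ s, ‖x' - x‖ < δ →
      ‖f x' - f x - f' (x' - x)‖ ≤ ε * ‖x' - x‖ := by
  rw [hasFDerivWithinAt_iff_tendsto, Metric.tendsto_nhdsWithin_nhds]
  constructor
  · intro h ε hε
    obtain ⟨δ, hδ, hall⟩ := h ε hε
    refine ⟨δ, hδ, fun x' hx' hlt => ?_⟩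
    rcases eq_or_ne x' x with rfl | hne
    · simp
    · have hpos : 0 < ‖x' - x‖ := norm_pos_iff.2 (sub_ne_zero.2 hne)
      have := hall hx' (by rwa [dist_eq_norm])
      rw [Real.dist_eq, sub_zero, abs_of_nonneg (by positivity)] at this
      have h2 := mul_lt_mul_of_pos_left this hpos
      rw [mul_inv_cancel_left₀ hpos.ne', mul_comm ‖x' - x‖ ε] at h2
      exact h2.le
  · intro h ε hε
    obtain ⟨δ, hδ, hall⟩ := h (ε / 2) (half_pos hε)
    refine ⟨δ, hδ, fun {x'} hx' hlt => ?_⟩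
    rw [Real.dist_eq, sub_zero, abs_of_nonneg (by positivity)]
    rcases eq_or_ne x' x with rfl | hne
    · simpa using hε
    · have hpos : 0 < ‖x' - x‖ := norm_pos_iff.2 (sub_ne_zero.2 hne)
      have := hall x' hx' (by rwa [dist_eq_norm] at hlt)
      calc ‖x' - x‖⁻¹ * ‖f x' - f x - f' (x' - x)‖
          ≤ ‖x' - x‖⁻¹ * (ε / 2 * ‖x' - x‖) := by gcongr
        _ = ε / 2 := by field_simp
        _ < ε := half_lt_self hε

/-- Sup-norm balls in coordinates. [folklore] -/
theorem soloInformed_pi_norm_sub_lt_iff {n : ℕ} {u v : Fin n → ℝ} {δ : ℝ} (hδ : 0 < δ) :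
    ‖u - v‖ < δ ↔ ∀ i, |u i - v i| < δ := by
  rw [pi_norm_lt_iff hδ]
  simp only [Pi.sub_apply, Real.norm_eq_abs]

/-- `‖v‖ ≤ ε‖u‖` in the sup norm, in coordinates. [folklore] -/
theorem soloInformed_pi_norm_le_mul_iff {n : ℕ} (v u : Fin n → ℝ) {ε : ℝ} (hε : 0 < ε) :
    ‖v‖ ≤ ε * ‖u‖ ↔ ∀ i, ∃ j, |v i| ≤ ε * |u j| := by
  constructor
  · intro h i
    have hne : (Finset.univ : Finset (Fin n)).Nonempty := ⟨i, Finset.mem_univ i⟩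
    obtain ⟨j, -, hj⟩ := Finset.exists_max_image Finset.univ (fun j => |u j|) hne
    refine ⟨j, ?_⟩
    have hu : ‖u‖ ≤ |u j| := (pi_norm_le_iff_of_nonneg (abs_nonneg _)).2 fun k => by
      rw [Real.norm_eq_abs]
      exact hj k (Finset.mem_univ k)
    calc |v i| = ‖v i‖ := (Real.norm_eq_abs _).symm
      _ ≤ ‖v‖ := norm_le_pi_norm v i
      _ ≤ ε * ‖u‖ := h
      _ ≤ ε * |u j| := by gcongr
  · intro h
    refine (pi_norm_le_iff_of_nonneg (by positivity)).2 fun i => ?_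
    obtain ⟨j, hj⟩ := h i
    calc ‖v i‖ = |v i| := Real.norm_eq_abs _
      _ ≤ ε * |u j| := hj
      _ = ε * ‖u j‖ := by rw [Real.norm_eq_abs]
      _ ≤ ε * ‖u‖ := by gcongr; exact norm_le_pi_norm u j

/-- The Fréchet derivative given by a matrix, within a set, in sup-norm coordinates.
[folklore] -/
theorem soloInformed_hasFDerivWithinAt_matrix_iff {n : ℕ} {Φ : (Fin n → ℝ) → (Fin n → ℝ)}
    {s : Set (Fin n → ℝ)} {x : Fin n → ℝ} (L : Matrix (Fin n) (Fin n) ℝ) :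
    HasFDerivWithinAt Φ (LinearMap.toContinuousLinearMap (Matrix.toLin' L)) s x ↔
      ∀ ε > 0, ∃ δ > 0, ∀ x' ∈ s, (∀ i, |x' i - x i| < δ) →
        ∀ i, ∃ j, |Φ x' i - Φ x i - ∑ k, L i k * (x' k - x k)| ≤ ε * |x' j - x j| := by
  have hmv : ∀ (v : Fin n → ℝ) (i : Fin n), L.mulVec v i = ∑ k, L i k * v k := fun _ _ => rfl
  rw [soloInformed_hasFDerivWithinAt_iff_eps_delta]
  refine forall₂_congr fun ε hε => exists_congr fun δ => and_congr_right fun hδ => ?_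
  refine forall₂_congr fun x' _ => ?_
  rw [soloInformed_pi_norm_sub_lt_iff hδ, soloInformed_pi_norm_le_mul_iff _ _ hε]
  simp only [Pi.sub_apply, LinearMap.coe_toContinuousLinearMap', Matrix.toLin'_apply, hmv]

/-- The determinant of the continuous linear map of a matrix. [folklore] -/
theorem soloInformed_det_toContinuousLinearMap_toLin' {n : ℕ} (L : Matrix (Fin n) (Fin n) ℝ) :
    (LinearMap.toContinuousLinearMap (Matrix.toLin' L)).det = L.det := by
  simp [ContinuousLinearMap.det]

/-! ### Meaning of the clauses -/

namespace SoloInformedPMap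

variable {K : Type} {n : ℕ} {M : SoloInformedPMap K n n} {T T' : SoloInformedPTerm K n}
  {p : K → ℝ} {Φ : (Fin n → ℝ) → (Fin n → ℝ)} {g g' : (Fin n → ℝ) → ℝ}

/-- **Meaning of the injectivity clause.** [cite: KontsevichZagier2001, §1.2 rule (2)] -/
theorem injClause_iff (hG : ∀ x ∈ M.fibre p, ∀ y, Fin.append x y ∈ M.gfibre p ↔ y = Φ x) :
    M.SoloInformedInjClause p ↔ InjOn Φ (M.fibre p) := by
  constructor
  · intro h x hx x' hx' hxx
    funext i
    have := h x (Sum.elim x' (Φ x)) hx (by rw [Sum.elim_comp_inl]; exact hx')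
      (by rw [Sum.elim_comp_inr]; exact (hG x hx _).2 rfl)
      (by rw [Sum.elim_comp_inl, Sum.elim_comp_inr]; exact (hG x' hx' _).2 hxx)
    simpa only [Sum.elim_inl] using this i
  · intro h x w hx hx' h1 h2 i
    have e1 := (hG x hx _).1 h1
    have e2 := (hG _ hx' _).1 h2
    exact congrFun (h hx hx' (e1.symm.trans e2)) i

/-- **Meaning of the image clause.** [cite: KontsevichZagier2001, §1.2 rule (2)] -/
theorem imgClause_iff (hG : ∀ x ∈ M.fibre p, ∀ y, Fin.append x y ∈ M.gfibre p ↔ y = Φ x) :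
    M.SoloInformedImgClause T' p ↔ T'.fibre p = Φ '' M.fibre p := by
  unfold SoloInformedImgClause
  rw [Set.ext_iff]
  refine forall_congr' fun y => iff_congr Iff.rfl ?_
  rw [mem_image]
  refine exists_congr fun x => ?_
  constructor
  · rintro ⟨hx, hy⟩
    exact ⟨hx, ((hG x hx y).1 hy).symm⟩
  · rintro ⟨hx, hy⟩
    exact ⟨hx, (hG x hx y).2 hy.symm⟩

/-- The Jacobian block of the differentiability clause. [cite: KontsevichZagier2001, §1.2] -/
theorem diffClause_jac_iff (hG : ∀ x ∈ M.fibre p, ∀ y, Fin.append x y ∈ M.gfibre p ↔ y = Φ x)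
    (hgT : ∀ x ∈ M.fibre p, ∀ t, Fin.snoc x t ∈ T.gfibre p ↔ t = g x)
    (hgT' : ∀ y ∈ T'.fibre p, ∀ t, Fin.snoc y t ∈ T'.gfibre p ↔ t = g' y)
    (hΦ : ∀ x ∈ M.fibre p, Φ x ∈ T'.fibre p) {x : Fin n → ℝ} (hx : x ∈ M.fibre p)
    (L : Matrix (Fin n) (Fin n) ℝ) :
    (∀ w : Fin n ⊕ Fin 2 → ℝ, Fin.append x (w ∘ Sum.inl) ∈ M.gfibre p →
      Fin.snoc x (w (Sum.inr 0)) ∈ T.gfibre p →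
        Fin.snoc (w ∘ Sum.inl) (w (Sum.inr 1)) ∈ T'.gfibre p →
          w (Sum.inr 0) = w (Sum.inr 1) * |L.det|) ↔ g x = g' (Φ x) * |L.det| := by
  constructor
  · intro h
    have := h (Sum.elim (Φ x) ![g x, g' (Φ x)])
      (by rw [Sum.elim_comp_inl]; exact (hG x hx _).2 rfl)
      (by rw [Sum.elim_inr]; exact (hgT x hx _).2 (by simp))
      (by rw [Sum.elim_comp_inl, Sum.elim_inr]; exact (hgT' _ (hΦ x hx) _).2 (by simp))
    simpa using this
  · intro h w h1 h2 h3
    have e1 : w ∘ Sum.inl = Φ x := (hG x hx _).1 h1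
    have e2 : w (Sum.inr 0) = g x := (hgT x hx _).1 h2
    rw [e1] at h3
    have e3 : w (Sum.inr 1) = g' (Φ x) := (hgT' _ (hΦ x hx) _).1 h3
    rw [e2, e3]
    exact h

/-- The derivative block of the differentiability clause. [cite: KontsevichZagier2001, §1.2] -/
theorem diffClause_der_iff (hG : ∀ x ∈ M.fibre p, ∀ y, Fin.append x y ∈ M.gfibre p ↔ y = Φ x)
    {x : Fin n → ℝ} (hx : x ∈ M.fibre p) (L : Matrix (Fin n) (Fin n) ℝ) :
    (∀ ε : Fin 1 → ℝ, 0 < ε 0 → ∃ δ : Fin 1 → ℝ, 0 < δ 0 ∧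
      ∀ w : Fin n ⊕ (Fin n ⊕ Fin n) → ℝ, w ∘ Sum.inl ∈ M.fibre p →
        Fin.append (w ∘ Sum.inl) (w ∘ Sum.inr ∘ Sum.inl) ∈ M.gfibre p →
          Fin.append x (w ∘ Sum.inr ∘ Sum.inr) ∈ M.gfibre p →
            (∀ i, (w (Sum.inl i) - x i) ^ 2 < δ 0 ^ 2) →
              ∀ i, ∃ j, (w (Sum.inr (Sum.inl i)) - w (Sum.inr (Sum.inr i)) -
                ∑ k, L i k * (w (Sum.inl k) - x k)) ^ 2 ≤
                  ε 0 ^ 2 * (w (Sum.inl j) - x j) ^ 2) ↔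
      HasFDerivWithinAt Φ (LinearMap.toContinuousLinearMap (Matrix.toLin' L))
        (M.fibre p) x := by
  rw [soloInformed_hasFDerivWithinAt_matrix_iff]
  constructor
  · intro h ε hε
    obtain ⟨δ, hδ, hall⟩ := h (fun _ => ε) hε
    refine ⟨δ 0, hδ, fun x' hx' hlt i => ?_⟩
    obtain ⟨j, hj⟩ := hall (Sum.elim x' (Sum.elim (Φ x') (Φ x)))
      (by rw [Sum.elim_comp_inl]; exact hx')
      (by rw [Sum.elim_comp_inl, ← Function.comp_assoc, Sum.elim_comp_inr, Sum.elim_comp_inl]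
          exact (hG x' hx' _).2 rfl)
      (by rw [← Function.comp_assoc, Sum.elim_comp_inr, Sum.elim_comp_inr]
          exact (hG x hx _).2 rfl)
      (fun i => by
        rw [Sum.elim_inl]
        exact (SoloInformedPTerm.sq_lt_sq_iff_abs_lt hδ).2 (hlt i)) i
    refine ⟨j, (SoloInformedPTerm.sq_le_mul_sq_iff hε).1 ?_⟩
    simpa only [Sum.elim_inl, Sum.elim_inr] using hj
  · intro h ε hε
    obtain ⟨δ, hδ, hall⟩ := h (ε 0) hε
    refine ⟨fun _ => δ, hδ, fun w hx' h1 h2 hlt i => ?_⟩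
    have e1 : w ∘ Sum.inr ∘ Sum.inl = Φ (w ∘ Sum.inl) := (hG _ hx' _).1 h1
    have e2 : w ∘ Sum.inr ∘ Sum.inr = Φ x := (hG x hx _).1 h2
    obtain ⟨j, hj⟩ := hall (w ∘ Sum.inl) hx'
      (fun i => (SoloInformedPTerm.sq_lt_sq_iff_abs_lt hδ).1 (hlt i)) i
    refine ⟨j, (SoloInformedPTerm.sq_le_mul_sq_iff hε).2 ?_⟩
    have c1 : w (Sum.inr (Sum.inl i)) = Φ (w ∘ Sum.inl) i := congrFun e1 i
    have c2 : w (Sum.inr (Sum.inr i)) = Φ x i := congrFun e2 i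
    rw [c1, c2]
    exact hj

/-- **Meaning of the differentiability/Jacobian clause.**
[cite: KontsevichZagier2001, §1.2 rule (2)] -/
theorem diffClause_iff (hG : ∀ x ∈ M.fibre p, ∀ y, Fin.append x y ∈ M.gfibre p ↔ y = Φ x)
    (hgT : ∀ x ∈ M.fibre p, ∀ t, Fin.snoc x t ∈ T.gfibre p ↔ t = g x)
    (hgT' : ∀ y ∈ T'.fibre p, ∀ t, Fin.snoc y t ∈ T'.gfibre p ↔ t = g' y)
    (hΦ : ∀ x ∈ M.fibre p, Φ x ∈ T'.fibre p) :
    M.SoloInformedDiffClause T T' p ↔ ∀ x ∈ M.fibre p, ∃ L : Matrix (Fin n) (Fin n) ℝ,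
      g x = g' (Φ x) * |L.det| ∧
        HasFDerivWithinAt Φ (LinearMap.toContinuousLinearMap (Matrix.toLin' L))
          (M.fibre p) x := by
  unfold SoloInformedDiffClause
  refine forall₂_congr fun x hx => ?_
  constructor
  · rintro ⟨L, hJ, hD⟩
    exact ⟨Matrix.of fun i j => L (i, j), (diffClause_jac_iff hG hgT hgT' hΦ hx _).1 hJ,
      (diffClause_der_iff hG hx _).1 hD⟩
  · rintro ⟨L, hJ, hD⟩
    exact ⟨fun q => L q.1 q.2, (diffClause_jac_iff hG hgT hgT' hΦ hx L).2 hJ,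
      (diffClause_der_iff hG hx L).2 hD⟩

end SoloInformedPMap

end Summit.KontsevichZagierPeriods.KontsevichZagierPeriods.Theorems
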